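import Summits.QuantumAdvantage.QuantumAdvantage.Theses.CubicForrelation
import Literature.Computability.QuantumComplexity.ForrelationSignTransport

/-!
# Crux `CubicForrelation.ExactPairsMaioranaMcFarland` (stmt-QuantumAdvantage-2205) — toward stub `stub_defect_vanishing`, II: Dillon duality and hyperplane restrictions

Line `two-adic-local-nongeneric`, stub `stub_defect_vanishing` (the β-half / DEFECT FORM): for an exact cubic pair
(`f`, `g` cubic on `m + m` bits, `g` bent with dual `f`: `W_g = 2^m (-1)^f`) that has an `m`-dimensional SINGULAR
subspace `V` of the cubic form of `g` (all second derivatives `D_a D_b g`, `a b ∈ V`, CONSTANT in `x`), some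
`m`-dimensional `V′` should carry VANISHING second derivatives (Dillon's criterion).  That statement is open
mathematics (implied by the crux; no proof known for `m ≥ 5`) and is NOT proved here; this is one of four `dv_`
helper files (`…DefectVanishing`, `…DefectVanishingDillonDual`, `…DefectVanishingCarlet`,
`…DefectVanishingSmallCases`) landing the provable structure around it, in the crux's definition-free vocabulary
(second derivatives as 4-fold xors `g x ⊕ g (x ⊕ a) ⊕ g (x ⊕ b) ⊕ g (x ⊕ a ⊕ b)`, subspaces as xor-closed finsets of
size `2^k`).

This file (all for `g` on `n` bits with `W_g = c·(-1)^f`, e.g. `c = 2^m`, `n = m + m`: `g` bent with dual `f`):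
* the ANNIHILATOR `V^⊥ = {u : (-1)^{x·u} = 1 ∀ x ∈ V}` of an xor-closed `V` with `|V| = 2^k`, `n = k + l`:
  xor-closed, `∋ 0`, of size `2^l` (`dv_perp_basics`, double counting);
* POISSON SUMMATION over cosets for such a pair: `|V| Σ_{p ∈ V^⊥} (-1)^{g(r⊕p) + u·(r⊕p)} =
  c Σ_{x ∈ V} (-1)^{x·r} (-1)^{f(u⊕x)}` (`dv_coset_poisson`, from `DerivativeWalsh.card_mul_sum_coset`), and the
  dual of the dual `W_f = 2^m (-1)^g` (`dv_dual_dual`);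
* DILLON DUALITY (J. F. Dillon, PhD thesis, Univ. of Maryland (1974); C. Carlet, *Boolean Functions for
  Cryptography and Coding Theory* (CUP 2021), §6.1): if `g` is affine on every coset of `V^⊥` (`|V| = 2^m`) then
  `f` is affine on every coset of `V` (`dv_dillon_dual`); the direction the stub needs: a `V` whose annihilator is
  a Dillon subspace of the DUAL `f` is a Dillon subspace of `g` (`dv_dillon_of_dual`).  Ingredients: character sums
  of multiplicative `±1`-functions over xor-closed sets (`dv_sum_char_subspace`), extremal sign sums
  (`dv_all_eq_of_sum_eq`), Parseval on `V` (`DerivativeWalsh.exists_twist_sum_ne_zero`);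
* HYPERPLANE RESTRICTIONS (O. Rothaus, On "bent" functions, JCTA 20 (1976); Carlet 2021, §6.1):
  `2 Σ_{w·p = 0} (-1)^{g(r ⊕ p)} = 2^m ((-1)^{f(0)} + (-1)^{w·r} (-1)^{f(w)}) ∈ {0, ±2^{m+1}}` for `w ≠ 0`
  (`dv_hyperplane_sum`; used for the case `m = 2` in the sibling file `…SmallCases`).

What is NOT here: the stub (open for `m ≥ 3`), the defect-form calculus, Carlet moves, the case `m = 2` (sibling
files).  Everything is proved from the tree and Mathlib; no named facts.
-/

set_option linter.dupNamespace false -- D-0017: single-problem summit ⇒ `QuantumAdvantage.QuantumAdvantage` by design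

namespace Summit.QuantumAdvantage.QuantumAdvantage.Theorems.CubicForrelation.ExactPairsMaioranaMcFarland

open Finset
open Literature.Computability.QuantumComplexity
open Literature.Computability.QuantumComplexity.BuzetChailloux (bxor)
open Literature.Computability.QuantumComplexity.BuzetChailloux (zeroVec bxor_comm bxor_self bxor_zeroVec
  zeroVec_bxor bxor_bxor_cancel_left bxor_eq_zeroVec_iff twist_bxor_right twist_zeroVec_right sum_twist_left signOf_sq)
open Literature.Computability.QuantumComplexity.Simon (twist_eq_one_or twist_sq sum_twist)
open Literature.Computability.QuantumComplexity.DerivativeWalsh (twist_bxor_left sum_twist_subspace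
  card_mul_sum_coset exists_twist_sum_ne_zero)

/-! ### Signs -/

/-- `(-1)^[b] = ±1`. -/
theorem dv_signOf_pm (b : Bool) : signOf b = 1 ∨ signOf b = -1 := by
  cases b <;> simp [signOf]

/-- A product of two signs is a sign. -/
theorem dv_pm_mul {s t : ℝ} (hs : s = 1 ∨ s = -1) (ht : t = 1 ∨ t = -1) : s * t = 1 ∨ s * t = -1 := by
  rcases hs with rfl | rfl <;> rcases ht with rfl | rfl <;> norm_num

/-- If four Booleans xor to `false`, the last sign is the product of the other three. -/
theorem dv_signOf_of_xor4 (p q r s : Bool) (h : (p ^^ q ^^ r ^^ s) = false) :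
    signOf s = signOf p * signOf q * signOf r := by
  revert h
  cases p <;> cases q <;> cases r <;> cases s <;> simp [signOf]

/-- Four Booleans whose signs multiply to `1` xor to `false`. -/
theorem dv_xor4_of_signOf (p q r s : Bool) (h : signOf p * signOf q * signOf r * signOf s = 1) :
    (p ^^ q ^^ r ^^ s) = false := by
  revert h
  cases p <;> cases q <;> cases r <;> cases s <;> norm_num [signOf]

/-! ### Character sums over xor-closed sets -/

/-- **A multiplicative `±1`-valued function sums to `|U|` or to `0` over an xor-closed `U`** (if some `ψ(x₀) = -1`,
reindexing by `x ↦ x₀ ⊕ x` negates the sum). -/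
theorem dv_sum_char_subspace {n : ℕ} {U : Finset (Fin n → Bool)} (hadd : ∀ x ∈ U, ∀ y ∈ U, bxor x y ∈ U)
    (ψ : (Fin n → Bool) → ℝ) (hmul : ∀ x ∈ U, ∀ y ∈ U, ψ (bxor x y) = ψ x * ψ y)
    (hpm : ∀ x ∈ U, ψ x = 1 ∨ ψ x = -1) :
    ∑ x ∈ U, ψ x = U.card ∨ ∑ x ∈ U, ψ x = 0 := by
  by_cases hall : ∀ x ∈ U, ψ x = 1
  · left
    rw [Finset.sum_congr rfl hall, Finset.sum_const, nsmul_eq_mul, mul_one]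
  · right
    push Not at hall
    obtain ⟨x₀, hx₀, hne⟩ := hall
    have hneg : ψ x₀ = -1 := (hpm x₀ hx₀).resolve_left hne
    have key : ∑ x ∈ U, ψ (bxor x₀ x) = ∑ x ∈ U, ψ x :=
      Finset.sum_nbij' (fun x => bxor x₀ x) (fun x => bxor x₀ x)
        (fun a ha => hadd x₀ hx₀ a ha) (fun a ha => hadd x₀ hx₀ a ha)
        (fun a _ => bxor_bxor_cancel_left x₀ a) (fun a _ => bxor_bxor_cancel_left x₀ a)
        (fun a _ => rfl)
    have h2 : ∑ x ∈ U, ψ (bxor x₀ x) = ψ x₀ * ∑ x ∈ U, ψ x := by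
      rw [Finset.mul_sum]
      exact Finset.sum_congr rfl fun x hx => hmul x₀ hx₀ x hx
    rw [hneg] at h2
    linarith [key.symm.trans h2]

/-- **Extremal sign sums are constant**: if `±1`-valued `t` sums to `ε·|s|` over `s` (`ε = ±1`) then `t ≡ ε` on
`s`. -/
theorem dv_all_eq_of_sum_eq {α : Type*} (s : Finset α) (t : α → ℝ) (ε : ℝ)
    (ht : ∀ x ∈ s, t x = 1 ∨ t x = -1) (hε : ε = 1 ∨ ε = -1) (hsum : ∑ x ∈ s, t x = ε * s.card) :
    ∀ x ∈ s, t x = ε := by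
  have hεε : ε * ε = 1 := by rcases hε with h | h <;> rw [h] <;> norm_num
  have hnn : ∀ x ∈ s, 0 ≤ 1 - ε * t x := by
    intro x hx
    rcases ht x hx with h | h <;> rcases hε with h' | h' <;> rw [h, h'] <;> norm_num
  have hzero : ∑ x ∈ s, (1 - ε * t x) = 0 := by
    rw [Finset.sum_sub_distrib, Finset.sum_const, nsmul_eq_mul, mul_one, ← Finset.mul_sum, hsum, ← mul_assoc,
      hεε, one_mul, sub_self]
  intro x hx
  have h := (Finset.sum_eq_zero_iff_of_nonneg hnn).1 hzero x hx
  have h1 : ε * t x = 1 := by linarith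
  rcases hε with rfl | rfl
  · linarith
  · linarith

/-! ### The annihilator `V^⊥` and Poisson summation over cosets -/

/-- **The annihilator of an xor-closed set.**  For an xor-closed `V ⊆ 𝔽₂ⁿ`, `n = k + l`, with `|V| = 2^k`, the set
`V^⊥ = {u : (-1)^{x·u} = 1 ∀ x ∈ V}` is xor-closed, contains `0`, and has `2^l` elements (double counting
`Σ_u Σ_{x ∈ V} (-1)^{x·u} = 2^{k+l}`). -/
theorem dv_perp_basics {n k l : ℕ} (hn : n = k + l) {V : Finset (Fin n → Bool)}
    (hVx : ∀ a ∈ V, ∀ b ∈ V, bxor a b ∈ V) (hVc : V.card = 2 ^ k) :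
    (∀ a ∈ (univ.filter fun u : Fin n → Bool => ∀ x ∈ V, twist x u = 1),
        ∀ b ∈ (univ.filter fun u : Fin n → Bool => ∀ x ∈ V, twist x u = 1),
          bxor a b ∈ (univ.filter fun u : Fin n → Bool => ∀ x ∈ V, twist x u = 1)) ∧
      zeroVec ∈ (univ.filter fun u : Fin n → Bool => ∀ x ∈ V, twist x u = 1) ∧
      (univ.filter fun u : Fin n → Bool => ∀ x ∈ V, twist x u = 1).card = 2 ^ l := by
  have h0 : zeroVec ∈ V := by
    obtain ⟨a, ha⟩ := Finset.card_pos.1 (by rw [hVc]; positivity)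
    have h := hVx a ha a ha
    rwa [bxor_self] at h
  refine ⟨?_, ?_, ?_⟩
  · intro a ha b hb
    simp only [Finset.mem_filter, Finset.mem_univ, true_and] at ha hb ⊢
    intro x hx
    rw [twist_bxor_right, ha x hx, hb x hx, mul_one]
  · exact Finset.mem_filter.2 ⟨Finset.mem_univ _, fun x _ => twist_zeroVec_right x⟩
  · have h1 : ∑ u : Fin n → Bool, ∑ x ∈ V, twist x u = (V.card : ℝ) *
        ((univ.filter fun u : Fin n → Bool => ∀ x ∈ V, twist x u = 1).card : ℝ) := by
      rw [Finset.sum_congr rfl fun u _ => sum_twist_subspace hVx u, ← Finset.sum_filter, Finset.sum_const,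
        nsmul_eq_mul, mul_comm]
    have h2 : ∑ u : Fin n → Bool, ∑ x ∈ V, twist x u = (2 : ℝ) ^ n := by
      rw [Finset.sum_comm, Finset.sum_congr rfl fun x _ => sum_twist x, Finset.sum_ite_eq',
        if_pos (show ((fun _ => false) : Fin n → Bool) ∈ V from h0)]
    have h2n : (2 : ℝ) ^ n = 2 ^ k * 2 ^ l := by rw [hn, pow_add]
    rw [h1, hVc, h2n] at h2
    push_cast at h2
    exact_mod_cast mul_left_cancel₀ (by positivity) h2

/-- **Poisson summation over a coset, for a pair with `W_g = c·(-1)^f`**: for xor-closed `V` and any `r u`,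
`|V| · Σ_{p ∈ V^⊥} (-1)^{g(r ⊕ p)} (-1)^{(r ⊕ p)·u} = c · Σ_{x ∈ V} (-1)^{x·r} (-1)^{f(u ⊕ x)}`
— `g` summed over the coset `r ⊕ V^⊥` against `f` summed over the coset `u ⊕ V`
(`DerivativeWalsh.card_mul_sum_coset` applied to `y ↦ (-1)^{g(y) + y·u}`, whose Walsh transform is `W_g(u ⊕ ·)`). -/
theorem dv_coset_poisson {n : ℕ} (f g : (Fin n → Bool) → Bool) (c : ℝ)
    (hW : ∀ b, DerivativeWalsh.W (fun x => signOf (g x)) b = c * signOf (f b))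
    {V : Finset (Fin n → Bool)} (hVx : ∀ a ∈ V, ∀ b ∈ V, bxor a b ∈ V) (r u : Fin n → Bool) :
    (V.card : ℝ) * ∑ p ∈ univ.filter (fun p : Fin n → Bool => ∀ x ∈ V, twist x p = 1),
        signOf (g (bxor r p)) * twist (bxor r p) u =
      c * ∑ x ∈ V, twist x r * signOf (f (bxor u x)) := by
  have key := card_mul_sum_coset hVx (fun y => signOf (g y) * twist y u) r
  have hre : ∑ y ∈ univ.filter (fun y => ∀ x ∈ V, twist x (bxor r y) = 1), signOf (g y) * twist y u =
      ∑ p ∈ univ.filter (fun p : Fin n → Bool => ∀ x ∈ V, twist x p = 1),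
        signOf (g (bxor r p)) * twist (bxor r p) u := by
    symm
    refine Finset.sum_nbij' (fun p => bxor r p) (fun y => bxor r y) ?_ ?_ ?_ ?_ ?_
    · intro p hp
      simp only [Finset.mem_filter, Finset.mem_univ, true_and] at hp ⊢
      intro x hx
      rw [bxor_bxor_cancel_left]
      exact hp x hx
    · intro y hy
      simp only [Finset.mem_filter, Finset.mem_univ, true_and] at hy ⊢
      exact hy
    · intro p _
      exact bxor_bxor_cancel_left r p
    · intro y _
      exact bxor_bxor_cancel_left r y
    · intro p _
      rfl
  have hWu : ∀ x, DerivativeWalsh.W (fun y => signOf (g y) * twist y u) x = c * signOf (f (bxor u x)) := by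
    intro x
    rw [← hW (bxor u x), DerivativeWalsh.W, DerivativeWalsh.W]
    refine Finset.sum_congr rfl fun y _ => ?_
    rw [twist_bxor_right]
    ring
  rw [hre] at key
  rw [key, Finset.mul_sum]
  refine Finset.sum_congr rfl fun x _ => ?_
  rw [hWu]
  ring

/-! ### Dillon duality -/

/-- **The dual of the dual** (Fourier inversion): if `W_g(b) = 2^m (-1)^{f(b)}` on `m + m` bits then
`W_f(y) = 2^m (-1)^{g(y)}` — the dual `f` is bent with dual `g`. -/
theorem dv_dual_dual (m : ℕ) (f g : (Fin (m + m) → Bool) → Bool)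
    (hW : ∀ b, DerivativeWalsh.W (fun x => signOf (g x)) b = (2 : ℝ) ^ m * signOf (f b)) :
    ∀ y, DerivativeWalsh.W (fun b => signOf (f b)) y = (2 : ℝ) ^ m * signOf (g y) := by
  intro y
  have inv : ∑ b, DerivativeWalsh.W (fun x => signOf (g x)) b * twist b y = (2 : ℝ) ^ (m + m) * signOf (g y) := by
    have e1 : ∀ b : Fin (m + m) → Bool, DerivativeWalsh.W (fun x => signOf (g x)) b * twist b y =
        ∑ x, signOf (g x) * twist b (bxor x y) := by
      intro b
      rw [DerivativeWalsh.W, Finset.sum_mul]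
      refine Finset.sum_congr rfl fun x _ => ?_
      rw [twist_bxor_right, twist_comm x b]
      ring
    rw [Finset.sum_congr rfl fun b _ => e1 b, Finset.sum_comm]
    have e2 : ∀ x : Fin (m + m) → Bool, ∑ b, signOf (g x) * twist b (bxor x y) =
        signOf (g x) * if bxor x y = zeroVec then (2 : ℝ) ^ (m + m) else 0 := by
      intro x
      rw [← Finset.mul_sum, sum_twist_left]
    rw [Finset.sum_congr rfl fun x _ => e2 x]
    simp_rw [bxor_eq_zeroVec_iff, mul_ite, mul_zero]
    rw [Finset.sum_ite_eq' Finset.univ y, if_pos (Finset.mem_univ _)]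
    ring
  have e3 : ∑ b, DerivativeWalsh.W (fun x => signOf (g x)) b * twist b y =
      (2 : ℝ) ^ m * DerivativeWalsh.W (fun b => signOf (f b)) y := by
    rw [DerivativeWalsh.W, Finset.mul_sum]
    refine Finset.sum_congr rfl fun b _ => ?_
    rw [hW b]
    ring
  rw [e3, pow_add, mul_assoc] at inv
  exact mul_left_cancel₀ (by positivity) inv

/-- **Dillon duality** (Dillon 1974; Carlet, *Boolean Functions for Cryptography and Coding Theory* (2021),
§6.1.16 on class `M` and its dual).  Let `g` on `m + m` bits be bent with dual `f` (`W_g = 2^m (-1)^f`) and let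
`V` be xor-closed with `|V| = 2^m`.  If `g` is affine on every coset of the annihilator `V^⊥` (all
`D_a D_b g`, `a b ∈ V^⊥`, vanish), then `f` is affine on every coset of `V` (all `D_a D_b f`, `a b ∈ V`, vanish).
Proof: by Poisson summation (`dv_coset_poisson`) the character sums `S(r) = Σ_{x ∈ V} (-1)^{x·r} (-1)^{f(u ⊕ x)}`
of `f` on the coset `u ⊕ V` are, up to sign, sums over `V^⊥` of a MULTIPLICATIVE `±1`-function (affineness of
`g` on `r ⊕ V^⊥`), hence `∈ {0, ±2^m}` (`dv_sum_char_subspace`); one of them is non-zero (Parseval on `V`,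
`DerivativeWalsh.exists_twist_sum_ne_zero`), so `(-1)^{f(u ⊕ x)} = ± (-1)^{x·r}` on `V`, which is affine. -/
theorem dv_dillon_dual (m : ℕ) (f g : (Fin (m + m) → Bool) → Bool)
    (hW : ∀ b, DerivativeWalsh.W (fun x => signOf (g x)) b = (2 : ℝ) ^ m * signOf (f b))
    (V : Finset (Fin (m + m) → Bool)) (hVx : ∀ a ∈ V, ∀ b ∈ V, bxor a b ∈ V) (hVc : V.card = 2 ^ m)
    (hD : ∀ a ∈ (univ.filter fun p : Fin (m + m) → Bool => ∀ x ∈ V, twist x p = 1),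
      ∀ b ∈ (univ.filter fun p : Fin (m + m) → Bool => ∀ x ∈ V, twist x p = 1), ∀ y : Fin (m + m) → Bool,
        (g y ^^ g (bxor y a) ^^ g (bxor y b) ^^ g (bxor (bxor y a) b)) = false) :
    ∀ a ∈ V, ∀ b ∈ V, ∀ u : Fin (m + m) → Bool,
      (f u ^^ f (bxor u a) ^^ f (bxor u b) ^^ f (bxor (bxor u a) b)) = false := by
  intro a ha b hb u
  have hassoc : ∀ x a b : Fin (m + m) → Bool, bxor (bxor x a) b = bxor x (bxor a b) := fun x a b => by
    funext i
    show ((x i ^^ a i) ^^ b i) = (x i ^^ (a i ^^ b i))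
    cases x i <;> cases a i <;> cases b i <;> rfl
  obtain ⟨hPx, h0P, hPc⟩ := dv_perp_basics rfl hVx hVc
  have h0V : zeroVec ∈ V := by
    have h := hVx a ha a ha
    rwa [bxor_self] at h
  -- a good character `r` for `x ↦ (-1)^{f(u ⊕ x)}` on `V`
  obtain ⟨r, hr⟩ := exists_twist_sum_ne_zero ⟨zeroVec, h0V⟩ (fun x => signOf (f (bxor u x)))
    (fun x => signOf_sq _)
  -- Poisson summation
  have key := dv_coset_poisson f g ((2 : ℝ) ^ m) hW hVx r u
  rw [hVc] at key
  push_cast at key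
  have hS : ∑ x ∈ V, twist x r * signOf (f (bxor u x)) =
      ∑ p ∈ univ.filter (fun p : Fin (m + m) → Bool => ∀ x ∈ V, twist x p = 1),
        signOf (g (bxor r p)) * twist (bxor r p) u :=
    (mul_left_cancel₀ (by positivity) key).symm
  -- the multiplicative `±1`-function on `V^⊥` coming from affineness of `g` on `r ⊕ V^⊥`
  obtain ⟨ψ, hψ⟩ : ∃ ψ : (Fin (m + m) → Bool) → ℝ,
      ∀ p, ψ p = signOf (g r) * signOf (g (bxor r p)) * twist p u := ⟨_, fun _ => rfl⟩
  have hψ' : ∀ p, signOf (g (bxor r p)) * twist (bxor r p) u = signOf (g r) * twist r u * ψ p := by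
    intro p
    rw [hψ, twist_bxor_left]
    linear_combination (-(signOf (g (bxor r p)) * twist r u * twist p u)) * signOf_sq (g r)
  have hψmul : ∀ p ∈ (univ.filter fun p : Fin (m + m) → Bool => ∀ x ∈ V, twist x p = 1),
      ∀ q ∈ (univ.filter fun p : Fin (m + m) → Bool => ∀ x ∈ V, twist x p = 1), ψ (bxor p q) = ψ p * ψ q := by
    intro p hp q hq
    have h4 := hD p hp q hq r
    rw [hassoc] at h4
    rw [hψ, hψ, hψ, dv_signOf_of_xor4 _ _ _ _ h4, twist_bxor_left]
    ring
  have hψpm : ∀ p ∈ (univ.filter fun p : Fin (m + m) → Bool => ∀ x ∈ V, twist x p = 1), ψ p = 1 ∨ ψ p = -1 :=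
    fun p _ => by
      rw [hψ]
      exact dv_pm_mul (dv_pm_mul (dv_signOf_pm _) (dv_signOf_pm _)) (twist_eq_one_or p u)
  have hS' : ∑ x ∈ V, twist x r * signOf (f (bxor u x)) = signOf (g r) * twist r u *
      ∑ p ∈ univ.filter (fun p : Fin (m + m) → Bool => ∀ x ∈ V, twist x p = 1), ψ p := by
    rw [hS, Finset.mul_sum]
    exact Finset.sum_congr rfl fun p _ => hψ' p
  have hsum_eq : ∑ p ∈ univ.filter (fun p : Fin (m + m) → Bool => ∀ x ∈ V, twist x p = 1), ψ p = (2 : ℝ) ^ m := by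
    rcases dv_sum_char_subspace hPx ψ hψmul hψpm with h | h
    · rw [h, hPc]
      push_cast
      ring
    · exfalso
      apply hr
      show ∑ x ∈ V, twist x r * signOf (f (bxor u x)) = 0
      rw [hS', h, mul_zero]
  -- so every term of `S(r)` equals `ε = (-1)^{g r} (-1)^{r·u}`
  have hε : signOf (g r) * twist r u = 1 ∨ signOf (g r) * twist r u = -1 :=
    dv_pm_mul (dv_signOf_pm _) (twist_eq_one_or r u)
  have hall := dv_all_eq_of_sum_eq V (fun x => twist x r * signOf (f (bxor u x))) (signOf (g r) * twist r u)
    (fun x _ => dv_pm_mul (twist_eq_one_or x r) (dv_signOf_pm _)) hε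
    (by rw [hS', hsum_eq, hVc]; push_cast; ring)
  have e0 := hall zeroVec h0V
  have ea := hall a ha
  have eb := hall b hb
  have eab := hall (bxor a b) (hVx a ha b hb)
  rw [twist_comm, twist_zeroVec_right, one_mul, bxor_zeroVec] at e0
  rw [twist_bxor_left, ← hassoc] at eab
  have hta := twist_sq a r
  have htb := twist_sq b r
  have hεsq : (signOf (g r) * twist r u) ^ 2 = 1 := by
    rcases hε with h | h <;> rw [h] <;> norm_num
  have hsa : signOf (f (bxor u a)) = twist a r * (signOf (g r) * twist r u) := by
    linear_combination twist a r * ea - signOf (f (bxor u a)) * hta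
  have hsb : signOf (f (bxor u b)) = twist b r * (signOf (g r) * twist r u) := by
    linear_combination twist b r * eb - signOf (f (bxor u b)) * htb
  have hsab : signOf (f (bxor (bxor u a) b)) = twist a r * twist b r * (signOf (g r) * twist r u) := by
    linear_combination (twist a r * twist b r) * eab - signOf (f (bxor (bxor u a) b)) * twist b r ^ 2 * hta -
      signOf (f (bxor (bxor u a) b)) * htb
  apply dv_xor4_of_signOf
  rw [e0, hsa, hsb, hsab]
  linear_combination ((signOf (g r) * twist r u) ^ 2 * twist a r ^ 2 * twist b r ^ 2 +
    twist a r ^ 2 * twist b r ^ 2) * hεsq + twist b r ^ 2 * hta + htb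

/-- **Dillon duality, the direction the stub needs**: to exhibit a Dillon `m`-subspace for `g` it suffices to find
an xor-closed `V` with `|V| = 2^m` whose annihilator `V^⊥` is a Dillon subspace of the DUAL `f` (then `V` itself is
Dillon for `g`; `f` is bent with dual `g` by `dv_dual_dual`). -/
theorem dv_dillon_of_dual (m : ℕ) (f g : (Fin (m + m) → Bool) → Bool)
    (hW : ∀ b, DerivativeWalsh.W (fun x => signOf (g x)) b = (2 : ℝ) ^ m * signOf (f b))
    (V : Finset (Fin (m + m) → Bool)) (hVx : ∀ a ∈ V, ∀ b ∈ V, bxor a b ∈ V) (hVc : V.card = 2 ^ m)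
    (hD : ∀ a ∈ (univ.filter fun p : Fin (m + m) → Bool => ∀ x ∈ V, twist x p = 1),
      ∀ b ∈ (univ.filter fun p : Fin (m + m) → Bool => ∀ x ∈ V, twist x p = 1), ∀ y : Fin (m + m) → Bool,
        (f y ^^ f (bxor y a) ^^ f (bxor y b) ^^ f (bxor (bxor y a) b)) = false) :
    ∀ a ∈ V, ∀ b ∈ V, ∀ x : Fin (m + m) → Bool,
      (g x ^^ g (bxor x a) ^^ g (bxor x b) ^^ g (bxor (bxor x a) b)) = false :=
  dv_dillon_dual m g f (dv_dual_dual m f g hW) V hVx hVc hD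


/-! ### Hyperplane restrictions of bent functions -/

/-- The pair `{0, w}` (`w ≠ 0`) is xor-closed of size `2 = 2^1`. -/
theorem dv_pair_basics {n : ℕ} (w : Fin n → Bool) (hw : w ≠ zeroVec) :
    (∀ a ∈ ({zeroVec, w} : Finset (Fin n → Bool)), ∀ b ∈ ({zeroVec, w} : Finset (Fin n → Bool)),
        bxor a b ∈ ({zeroVec, w} : Finset (Fin n → Bool))) ∧
      ({zeroVec, w} : Finset (Fin n → Bool)).card = 2 ^ 1 := by
  refine ⟨?_, ?_⟩
  · intro a ha b hb
    simp only [Finset.mem_insert, Finset.mem_singleton] at ha hb ⊢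
    rcases ha with rfl | rfl <;> rcases hb with rfl | rfl <;> simp
  · rw [pow_one]
    exact Finset.card_pair (Ne.symm hw)

/-- The annihilator of `{0, w}` is the hyperplane `{p : (-1)^{w·p} = 1}`. -/
theorem dv_filter_pair {n : ℕ} (w : Fin n → Bool) :
    (univ.filter fun p : Fin n → Bool => ∀ x ∈ ({zeroVec, w} : Finset (Fin n → Bool)), twist x p = 1) =
      univ.filter fun p : Fin n → Bool => twist w p = 1 := by
  apply Finset.filter_congr
  intro p _
  simp only [Finset.mem_insert, Finset.mem_singleton, forall_eq_or_imp, forall_eq, twist_comm zeroVec p,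
    twist_zeroVec_right, true_and]

/-- **Hyperplane restrictions of a bent function** (Rothaus 1976; Carlet 2021, §6.1: restrictions to hyperplanes
are semi-bent).  If `W_g = 2^m (-1)^f` on `m + m` bits, `w ≠ 0` and `r` is any shift, then
`2 · Σ_{p : w·p = 0} (-1)^{g(r ⊕ p)} = 2^m ((-1)^{f(0)} + (-1)^{w·r} (-1)^{f(w)})`; in particular the sum is
`0` or `±2^m` (Poisson summation `dv_coset_poisson` with `V = {0, w}`). -/
theorem dv_hyperplane_sum (m : ℕ) (f g : (Fin (m + m) → Bool) → Bool)
    (hW : ∀ b, DerivativeWalsh.W (fun x => signOf (g x)) b = (2 : ℝ) ^ m * signOf (f b))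
    (w : Fin (m + m) → Bool) (hw : w ≠ zeroVec) (r : Fin (m + m) → Bool) :
    2 * ∑ p ∈ univ.filter (fun p : Fin (m + m) → Bool => twist w p = 1), signOf (g (bxor r p)) =
      (2 : ℝ) ^ m * (signOf (f zeroVec) + twist w r * signOf (f w)) := by
  obtain ⟨hVx, hVc⟩ := dv_pair_basics w hw
  have key := dv_coset_poisson f g ((2 : ℝ) ^ m) hW hVx r zeroVec
  rw [hVc, dv_filter_pair, Finset.sum_pair (Ne.symm hw)] at key
  simp only [twist_zeroVec_right, mul_one, zeroVec_bxor, twist_comm zeroVec r, one_mul] at key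
  push_cast at key
  linear_combination key

/-- **Registered sub-goal `stub_defect_vanishing_dillon_duality`** of the stub (= `dv_dillon_of_dual`): for `g`
bent with dual `f` on `m + m` bits, an xor-closed `V` with `|V| = 2^m` whose annihilator `V^⊥` is a Dillon subspace
of the dual `f` is a Dillon subspace of `g`. -/
theorem stub_defect_vanishing_dillon_duality :
    ∀ (m : ℕ) (f g : (Fin (m + m) → Bool) → Bool),
      (∀ b : Fin (m + m) → Bool, DerivativeWalsh.W (fun x => signOf (g x)) b = (2 : ℝ) ^ m * signOf (f b)) →
      ∀ V : Finset (Fin (m + m) → Bool), (∀ a ∈ V, ∀ b ∈ V, bxor a b ∈ V) → V.card = 2 ^ m →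
        (∀ a ∈ (Finset.univ.filter fun p : Fin (m + m) → Bool => ∀ x ∈ V, twist x p = 1),
          ∀ b ∈ (Finset.univ.filter fun p : Fin (m + m) → Bool => ∀ x ∈ V, twist x p = 1),
            ∀ y : Fin (m + m) → Bool, (f y ^^ f (bxor y a) ^^ f (bxor y b) ^^ f (bxor (bxor y a) b)) = false) →
        ∀ a ∈ V, ∀ b ∈ V, ∀ x : Fin (m + m) → Bool,
          (g x ^^ g (bxor x a) ^^ g (bxor x b) ^^ g (bxor (bxor x a) b)) = false :=
  dv_dillon_of_dual

end Summit.QuantumAdvantage.QuantumAdvantage.Theorems.CubicForrelation.ExactPairsMaioranaMcFarland
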